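import Literature.MathematicalPhysics.QuantumFieldTheory.Balaban1983to89.B9Eq349ConjugatedGreenBlockDecay
import Literature.MathematicalPhysics.QuantumFieldTheory.Balaban1983to89.B9Eq347LocalFromBlockDecay
import Literature.MathematicalPhysics.QuantumFieldTheory.Balaban1983to89.B9Eq347GlobalFromLocal

/-!
# `Balaban1983to89.B9Eq342GreenPrimeSupRowBlockRoad` — T. Bałaban, *Propagators for lattice gauge theories in a background field*, Commun. Math. Phys.
# **99** (1985) 389–434 [Balaban1985BackgroundPropagators] Thm 3.1 (3.42) p. 397 *«|(G′(U)λ)(x)| ≤ B₀(L^jη)²e^{−δ₀d(y,y′)}|λ| for x ∈ Δ(y), supp λ ⊂ Δ(y′)»*,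
# (3.47) p. 398 *«|G′(U)λ| ≤ B₀|λ|»* («the constant B₀ depends on d and L only»), read at ONE step (`j ≡ 0`, `L^jη = ηL = 1`) through (3.49) p. 399 and Thm 3.11
# p. 416: **THE BLOCK ROAD TO THE VALUE ROW OF (3.42) FOR PRINT's `G′(U)` — the cell's `L²` block decay of `G′(U)` on its window
# (`B9Eq349ConjugatedGreenBlockDecay.exists_block_decay_Gp`: `‖1_{Δ(y)}G′(U)1_{Δ(v)}‖ ≤ C·e^{r}·e^{−r·d_m(v,y)}`, ONE `C` for every background of the window)
# read pointwise by this lineage's `B9Eq347LocalFromBlockDecay` (price `√(L^d)`) and summed by `B9Eq347GlobalFromLocal`: `∃ B`, for every `U` of the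
# window, every `f` supported in `Δ(v)` with `‖f(y)‖ ≤ F`: `‖(G′(U)f)(x)‖ ≤ B·e^{−r·d_m(Δ(x),v)}·F`, `B = C·e^{r}·√(L^d)`; and `∃ B₀`, for every `f`:
# `‖(G′(U)f)(x)‖ ≤ B₀·sup‖f‖`, `B₀ = C·e^{r}·√(L^d)·K_d(r)`** — a SECOND, SHORTER closed value row next to the owner lineage's Kato ∕ supersolution road
# (`B9Eq342GreenPrimeSupBoundDecay*`, pub-balaban NE9 SUP-NORM PROGRAMME plan v10 storey (D)): no Kato form, no weights, no (D-FS)∕(D-P) letters — at the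
# price of the factor `√(L^d)`, which print allows at one step («B₀ depends on d and L») and which makes this road USELESS for the tower (there `√((L^{n+1})^d)`
# is the height) — the owner's road exists exactly to avoid it

statement-level skeleton of published theorems with citation tags; proofs where landed; nothing here is a claim about the Yang–Mills mass gap

CITATION HEADER (lean-in-tree rule).  Audit cell `pub-balaban`, sub-cell `t4`, BINDER row NE9; filed by NE9 crux-team LEAF PROVER 03
(`b2b-balaban-t4-ne9-formalise-leaf-03`, gen 71).  Composed BY NAME: ne9-leaf-01's `B9Eq349ConjugatedGreenBlockDecay.exists_block_decay_Gp` (the (D-E) letter,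
its window VERBATIM below), ne9-leaf-01's `B9Eq349BlockMultipliers.exists_block_clm_family` (a block family exists), this lineage's
`B9Eq347LocalFromBlockDecay.local_of_block_decay_sites` and `B9Eq347GlobalFromLocal.local_transport` ∕ `norm_apply_le_of_local_lattice`.  Sources READ
(renders `HOME/b2b-balaban-ref1/pages/1985-cmp99-background-propagators/…-p009∕p010∕p011`): [Balaban1985BackgroundPropagators] p. 397 (3.42), p. 398 (3.47) and
the sentence on `B₀`, p. 399 (3.49).  NOTHING printed is asserted: the window is the cell's, the constants are the cell's letters composed.

WHAT IS PROVED (sorry-free; proof lane — no `def`; [folklore] composition).  Data = the `Instance` section of `B9Eq349ConjugatedGreenBlockDecay` (fibre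
algebra `𝔸`, `φ : W ≃ 𝔸` with `M_φ`, `M_φ′`, weights `c₀`, `c₁ = L^dc₀`, `η > 0` with `ηL = 1`, `a′ > 0`, `ε_U ≥ 0`) and ITS window (`γ`, `β`, `r`, `ℓ`, `ℓ′`
binders copied token for token):
* **`exists_local_letter_GpOfU`** — `∃ B ≥ 0` such that for every background `U` of the window, every unit block `v`, every `f ∈ L²` supported in `Δ(v)` with
  `‖f(y)‖ ≤ F` and every site `x`: `‖(G′(U)f)(x)‖ ≤ B·e^{−r·d_m(Δ(x), v)}·F` (`B = C·e^{r}·√(L^d)`) — the letter (L) of `B9Eq347GlobalFromLocal` for print's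
  `G′(U)`, through `WL2.equiv`.
* **`exists_sup_row_GpOfU`** (`0 < r`) — `∃ B₀ ≥ 0` such that for every `U` of the window and EVERY `f`: `‖(G′(U)f)(x)‖ ≤ B₀·sup_y‖f(y)‖`
  (`B₀ = C·e^{r}·√(L^d)·K_d(r)`, `K_d` = `B4Sect5Proof.latticeConst`, volume-free) — (3.47)'s `|G′(U)λ|_∞ ≤ B₀|λ|_∞` at one step.
HONEST SCOPE.  One step only; `B₀` carries `√(L^d)` (print: «depends on d and L») and the cell's window constant `C = 4∕γ`; NOT height-free, NOT the tower
row, NOT a replacement of storey (D) (whose constants are `L`-free and whose tower twin is the (N)-reading's input); the ∇-row and the Hölder rows of (3.42)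
are not touched.  NOT Thm 3.1 as printed (print's proof is the random-walk expansion, uniform in `U` without a window), NOT NE9 (cell pub-balaban: NE9 NOT
PRINTED ∕ NOT PROVED; «NE9 ⇐ the named binders»; row WALLED ON A MODEL (O-NE9-1; #5 UNRULED); spine PROVED 0∕9; rung (B)+1 on a finite T⁴ — NOT infinite volume,
NOT mass gap, NOT Clay; HONEST DEPENDENCY: continuum YM on T⁴ ⇐ BetaPertH ∧ nine spine estimates (0/9 proved); BetaPertH ⇐ (D1) ∧ (D4) ∧ CAP+tail; G-an2-4 gates
asym, D1 and NE2/3/4).  NEW file importing `B9Eq349ConjugatedGreenBlockDecay`, `B9Eq347LocalFromBlockDecay`, `B9Eq347GlobalFromLocal`; nothing modified.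
Net new unproved facts: 0.
-/

noncomputable section

open scoped BigOperators InnerProductSpace

namespace Literature.MathematicalPhysics.QuantumFieldTheory.Balaban1983to89.B9Eq342GreenPrimeSupRowBlockRoad

open B4Sect5Torus (TSite tdist)
open B4Sect5Proof (latticeConst latticeConst_nonneg)
open B7Prop1Explicit (U1)
open B9SectCLatticeCarrier (Bond)
open B9Eq311L2Pairing (WL2)
open B9Eq319QprimeTorus (fineP blockCoord)
open B9Eq310HessianOperator (adTransportW)
open B11Eq103H1Complex (SiteL2K)
open B9Eq3119DeltaPiCarrier (laplacePrimeA GpOfU)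
open B9Thm311DeltaPrimeA (laplacePrimeA_pos_of_hRS)
open B9Eq349BlockMultipliers (exists_block_clm_family)
open B9Eq349ConjugatedGreenBlockDecay (exists_block_decay_Gp)
open B9Eq347LocalFromBlockDecay (local_of_block_decay_sites)
open B9Eq347GlobalFromLocal (local_transport norm_apply_le_of_local_lattice)

variable {d : ℕ} {L : ℕ} [NeZero L] {m : Fin d → ℕ} {𝔸 : Type*} [NormedRing 𝔸] [NormedAlgebra ℂ 𝔸] [NormOneClass 𝔸]
  {W : Type*} [NormedAddCommGroup W] [InnerProductSpace ℂ W] [FiniteDimensional ℂ W] {φ : W ≃ₗ[ℂ] 𝔸} {Mφ Mφ' : ℝ}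
  (hφ : ∀ w, ‖φ w‖ ≤ Mφ * ‖w‖) (hφ' : ∀ X, ‖φ.symm X‖ ≤ Mφ' * ‖X‖) (hMφ : 0 ≤ Mφ) (hMφ' : 0 ≤ Mφ')
  {c₀ : ℝ} [Fact (0 < c₀)] {η : ℝ} (hη : 0 < η) {εU : ℝ} (hεU : 0 ≤ εU)
  {c₁ : ℝ} [Fact (0 < c₁)] (hc : c₁ = (L : ℝ) ^ d * c₀) {a' : ℝ} (ha' : 0 < a') (hηL : η * L = 1)

include hφ hφ' hMφ hMφ' hη hεU hc ha' hηL in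
/-- **THE LETTER (L) FOR PRINT's `G′(U)` BY THE BLOCK ROAD**: on the window of `exists_block_decay_Gp` (its binders verbatim) there is ONE `B ≥ 0`
(`= C·e^{r}·√(L^d)`, `C = 4∕γ`) such that for every background `U` of the window, every unit block `v`, every `f` supported in `Δ(v)` with `‖f(y)‖ ≤ F` and
every fine site `x`: `‖(G′(U)f)(x)‖ ≤ B·e^{−r·d_m(Δ(x),v)}·F` — (3.42)'s first entry at one step, from the `L²` block decay read pointwise
(`B9Eq347LocalFromBlockDecay.local_of_block_decay_sites`, price `√(L^d)`). [cite: Balaban1985BackgroundPropagators, Thm 3.1 (3.42) p.397, (3.49) p.399, Thm 3.11 p.416] -/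
theorem exists_local_letter_GpOfU {γ β r : ℝ} (hγ : 0 < γ) (hβ : 0 ≤ β) (hr : 0 ≤ r)
    (hγc : γ ≤ 1 / (2 + 2 / a') -
        (Real.sqrt d * (‖((η : ℂ))⁻¹‖ * (2 * Mφ * Mφ' * εU)) + (Real.sqrt d * (‖((η : ℂ))⁻¹‖ * (2 * Mφ * Mφ' * εU))) ^ 2 +
          a' * (((1 + 2 * Mφ * Mφ' * εU) ^ (d * (L - 1)) - 1)) * (2 + ((1 + 2 * Mφ * Mφ' * εU) ^ (d * (L - 1)) - 1))))
    {ℓ ℓ' : ℝ} (hℓ : 1 ≤ ℓ) (hℓ' : 1 ≤ ℓ') (hwin : r * ℓ * η ≤ 1) (hwin' : r * ℓ' ≤ 1)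
    (hβD : 2 * r * ℓ * (Mφ * Mφ') * Real.sqrt d ≤ β) (hβQ : 2 * r * ℓ' * (1 + 2 * Mφ * Mφ' * εU) ^ (d * (L - 1)) ≤ β)
    (small : 3 * (1 + a') * β ^ 2 ≤ γ / 4) (hL : 1 ≤ L) (hm : ∀ i, 1 ≤ m i) :
    ∃ B : ℝ, 0 ≤ B ∧ ∀ (U : Bond d (fineP L m) → 𝔸ˣ) (hU : ∀ b, U b ∈ U1 𝔸) (hUε : ∀ b, ‖(U b : 𝔸) - 1‖ ≤ εU)
      (hRS : ∀ (b : Bond d (fineP L m)) (v u : W), ⟪adTransportW φ U b v, u⟫_ℂ = ⟪v, adTransportW φ (fun b => (U b)⁻¹) b u⟫_ℂ)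
      (v : TSite d m) (f : SiteL2K ℂ d (fineP L m) c₀ W) (F : ℝ),
      (∀ y, blockCoord L m y ≠ v → WL2.equiv ℂ (fun _ : TSite d (fineP L m) => c₀) W f y = 0) →
      (∀ y, ‖WL2.equiv ℂ (fun _ : TSite d (fineP L m) => c₀) W f y‖ ≤ F) →
      ∀ x : TSite d (fineP L m),
        ‖WL2.equiv ℂ (fun _ : TSite d (fineP L m) => c₀) W
            (GpOfU L m φ η U a' (c₁ := c₁) (fun x hx => laplacePrimeA_pos_of_hRS L m φ η U a' hη.ne' ha' hRS x hx) f) x‖ ≤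
          B * Real.exp (-(r * tdist m (blockCoord L m x) v)) * F := by
  classical
  obtain ⟨C, hC0, hC⟩ := exists_block_decay_Gp hφ hφ' hMφ hMφ' hη hεU hc ha' hηL hγ hβ hr hγc hℓ hℓ' hwin hwin' hβD hβQ small hL hm
  obtain ⟨PS, hPS⟩ := exists_block_clm_family (𝕜 := ℂ) (w := fun _ : TSite d (fineP L m) => c₀) (V := W) (blockCoord L m)
  refine ⟨C * Real.exp r * Real.sqrt ((L : ℝ) ^ d), by positivity, fun U hU hUε hRS v f F hfv hfF x => ?_⟩
  exact local_of_block_decay_sites hm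
    (LinearMap.toContinuousLinearMap
      (GpOfU L m φ η U a' (c₁ := c₁) (fun x hx => laplacePrimeA_pos_of_hRS L m φ η U a' hη.ne' ha' hRS x hx)))
    hPS hPS (C := C * Real.exp r) (by positivity) (fun v y => hC U hU hUε hRS PS hPS v y) v f F hfv hfF x

include hφ hφ' hMφ hMφ' hη hεU hc ha' hηL in
/-- **THE `L^∞ → L^∞` ROW OF PRINT's `G′(U)` BY THE BLOCK ROAD** ((3.47)'s «|G′(U)λ| ≤ B₀|λ|» at one step): on the same window, with `0 < r`, there is ONE
`B₀ ≥ 0` (`= C·e^{r}·√(L^d)·K_d(r)`) such that for every background `U` of the window and EVERY `f`: `‖(G′(U)f)(x)‖ ≤ B₀·sup_y‖f(y)‖` — the letter of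
`exists_local_letter_GpOfU` summed over the source blocks by `B9Eq347GlobalFromLocal.norm_apply_le_of_local_lattice` (`torusSum_le`, volume-free).
[cite: Balaban1985BackgroundPropagators, Thm 3.1 (3.47) p.398, (3.42) p.397, (3.49) p.399] [cite: Balaban1984PropagatorsII, Lemma 2.1 (2.61) p.234] -/
theorem exists_sup_row_GpOfU {γ β r : ℝ} (hγ : 0 < γ) (hβ : 0 ≤ β) (hr : 0 < r)
    (hγc : γ ≤ 1 / (2 + 2 / a') -
        (Real.sqrt d * (‖((η : ℂ))⁻¹‖ * (2 * Mφ * Mφ' * εU)) + (Real.sqrt d * (‖((η : ℂ))⁻¹‖ * (2 * Mφ * Mφ' * εU))) ^ 2 +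
          a' * (((1 + 2 * Mφ * Mφ' * εU) ^ (d * (L - 1)) - 1)) * (2 + ((1 + 2 * Mφ * Mφ' * εU) ^ (d * (L - 1)) - 1))))
    {ℓ ℓ' : ℝ} (hℓ : 1 ≤ ℓ) (hℓ' : 1 ≤ ℓ') (hwin : r * ℓ * η ≤ 1) (hwin' : r * ℓ' ≤ 1)
    (hβD : 2 * r * ℓ * (Mφ * Mφ') * Real.sqrt d ≤ β) (hβQ : 2 * r * ℓ' * (1 + 2 * Mφ * Mφ' * εU) ^ (d * (L - 1)) ≤ β)
    (small : 3 * (1 + a') * β ^ 2 ≤ γ / 4) (hL : 1 ≤ L) (hm : ∀ i, 1 ≤ m i) :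
    ∃ B₀ : ℝ, 0 ≤ B₀ ∧ ∀ (U : Bond d (fineP L m) → 𝔸ˣ) (hU : ∀ b, U b ∈ U1 𝔸) (hUε : ∀ b, ‖(U b : 𝔸) - 1‖ ≤ εU)
      (hRS : ∀ (b : Bond d (fineP L m)) (v u : W), ⟪adTransportW φ U b v, u⟫_ℂ = ⟪v, adTransportW φ (fun b => (U b)⁻¹) b u⟫_ℂ)
      (f : SiteL2K ℂ d (fineP L m) c₀ W) (F : ℝ), (∀ y, ‖WL2.equiv ℂ (fun _ : TSite d (fineP L m) => c₀) W f y‖ ≤ F) →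
      ∀ x : TSite d (fineP L m),
        ‖WL2.equiv ℂ (fun _ : TSite d (fineP L m) => c₀) W
            (GpOfU L m φ η U a' (c₁ := c₁) (fun x hx => laplacePrimeA_pos_of_hRS L m φ η U a' hη.ne' ha' hRS x hx) f) x‖ ≤ B₀ * F := by
  obtain ⟨B, hB0, hB⟩ := exists_local_letter_GpOfU hφ hφ' hMφ hMφ' hη hεU hc ha' hηL hγ hβ hr.le hγc hℓ hℓ' hwin hwin' hβD hβQ small hL hm
  refine ⟨B * latticeConst d r, mul_nonneg hB0 (latticeConst_nonneg d hr.le), fun U hU hUε hRS f F hfF x => ?_⟩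
  haveI : Nonempty (TSite d (fineP L m)) := ⟨x⟩
  have hF : 0 ≤ F := (norm_nonneg _).trans (hfF x)
  -- the letter for the plain-function operator `e ∘ G′(U) ∘ e⁻¹`, `e = WL2.linearEquiv`
  have hloc := local_transport (blockCoord L m) (WL2.linearEquiv ℂ ℂ (fun _ : TSite d (fineP L m) => c₀))
    (WL2.linearEquiv ℂ ℂ (fun _ : TSite d (fineP L m) => c₀))
    (GpOfU L m φ η U a' (c₁ := c₁) (fun x hx => laplacePrimeA_pos_of_hRS L m φ η U a' hη.ne' ha' hRS x hx))
    (rhs := fun x v F => B * Real.exp (-(r * tdist m (blockCoord L m x) v)) * F)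
    (fun v g F hg hg' x => by simpa using hB U hU hUε hRS v g F (fun y hy => by simpa using hg y hy) (fun y => by simpa using hg' y) x)
  have h := norm_apply_le_of_local_lattice L m _ hm hB0 hr hloc (WL2.equiv ℂ (fun _ : TSite d (fineP L m) => c₀) W f) hF hfF x
  simpa using h

end Literature.MathematicalPhysics.QuantumFieldTheory.Balaban1983to89.B9Eq342GreenPrimeSupRowBlockRoad

end
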